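import Summits.BirchSwinnertonDyer.Rank1Residual.X1.RankOneRegulatorSqueeze
import HarnessLib

/-!
# Route R on X1 ∩ {r = 1}, TIER file: the certified integer `s` of the regulator squeeze IS
# `ord_p #Ш(E/ℚ)_an` (granted Perrin-Riou 1987 + Gross–Zagier) — route R fires exactly where route B would

HONEST FRAMING (cell `b2b-bsdres`, run/shared/lean/b2b/bsd-rank1-residual/, verbatim in every
file): the goal of the cell is to DELETE the COMBINATION-SHAPED residual classes of the
Birch–Swinnerton-Dyer formula for ALL analytic-rank `≤ 1` elliptic curves over `ℚ` — "full BSD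
formula for every rank `≤ 1` curve in class `C`" assembled STRICTLY from published theorems — so
that the rank-`≤ 1` remainder becomes exactly the CONSTRUCTION-SHAPED classes, which are TYPED
(missing-input `Prop`s), NOT attempted. This is not "finishing BSD". CLASS-OWNERS.md: row
"X1 (r = 1)" — research route; NO CLAIM BEYOND STATED CLASSES; no label change. PER-PAIR shape;
nothing is booked by this file; no preprint enters.

Unit `b2b-bsdres-x1a` (X1 prover A, gen 16). Second sequel of `X1/RankOneRegulatorSqueeze.lean`
(p263077). Theorems only. WHAT: at a rank-one leaf pair with the two finite certificates of route R —
`ord_p [T¹](ϖ·L_p) = vc ≠ 0` (typed `AnalyticCoeffOneVal W p vc`) and the EXACT valuation `v` of THE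
canonical cyclotomic `p`-adic regulator — the analytic order of `Ш` is a non-zero rational `q` with
  `ord_p q = vc + 1 + 2·ord_p #E(ℚ)_tors − 2·ord_p #Ẽ(𝔽_p) − ord_p ∏c_ℓ − v  (= s)`
(`RankOne.Leaf.exists_shaAn_padicValRat_eq_of_coeffOneVal_of_regulatorEq`). So the census integer `s`
of route R (HOME/b2b-bsdres-x1a/gen16/ROUTE-R-R1.md) is, as a THEOREM over the published facts
Wuthrich 2014 Thm. 16, BMS Thm. 1.7, Perrin-Riou 1987 (`hPR`), Mazur–Tate `σ`, modularity, GZK, the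
`p`-adic valuation of `#Ш(E/ℚ)_an`: route R (`s = 0`, no `#Ш_an` input) and x1b's route B
(`p ∤ #Ш(E/ℚ)_an` + Schneider, `RankOne.Leaf.mazurMainConjecture_and_bsdp_of_shaAn_unit_of_schneider`)
fire on the SAME pairs — the gen-10 "consistency identity `D = −1`" of x1a (LW-FALLOUT-X1.md §6, 12 222
pairs) is this theorem read numerically. The proof combines x1b's rank-one engine
(`Wuthrich2014.exists_cofactor_of_mem_charIdeal_of_rank_one_odd`: `ord_p #Ш_an = ord_p h(0) + ord_p #Ш`)
with the valuation identity of route R at the SAME cofactor `h` (`identity_of_factor` below, the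
factor-explicit form of `RankOneRegulatorSqueeze.identity`).

References: [Wuthrich2014] Thm. 16 (p. 397), §6; [BalakrishnanMullerStein2015] Thm. 1.7;
[PerrinRiou1987] §1.4 Cor. 1.8; [MazurSteinTate2006] Thm. 1.3; [SteinWuthrich2013] §9.
-/

noncomputable section

open scoped Classical MatrixGroups ModularForm

open PowerSeries CongruenceSubgroup WeierstrassCurve Literature.NumberTheory.EllipticCurves
  Literature.NumberTheory.EllipticCurves.ModularForms
  Literature.NumberTheory.EllipticCurves.Wuthrich2014
  Literature.NumberTheory.EllipticCurves.Rank1Residual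
  Summit.BirchSwinnertonDyer.BirchSwinnertonDyer.Theorems
  Summit.BirchSwinnertonDyer.BirchSwinnertonDyer.Theorems.Rank1ResidualX1Defs
  Summit.BirchSwinnertonDyer.Rank1Residual.X1.MuLambda
  Summit.BirchSwinnertonDyer.Rank1Residual.X1.RankOneLeadingTermSqueeze

set_option autoImplicit false

namespace Summit.BirchSwinnertonDyer.Rank1Residual.X1.RankOneRegulatorSqueeze

section Factor

variable {W : WeierstrassCurve ℚ} [W.IsElliptic] [W.IsGloballyMinimal] {p : ℕ} [Fact p.Prime]

/-- **The rank-one valuation identity for a GIVEN factorisation `ϖ·L_p = ι(f_E·h)`** (`char X = (f_E)`,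
`X` torsion): `p ≠ 2` good ordinary, `rank E(ℚ) = 1`, `ord_p [T¹](ϖ·L_p) = vc ≠ 0`; facts BMS Thm. 1.7
at odd `p` (`hS`, all three clauses) and Mazur–Tate `σ` (`hMT`). Then `h(0) ≠ 0`, `Ш(E/ℚ)[p^∞]` is
finite and at every canonical height datum Schneider's non-degeneracy holds with
`ord_p #Ш(E/ℚ)[p^∞] + ord_p h(0) + ord_p Reg_p + ord_p ∏c_ℓ + 2·ord_p #Ẽ(𝔽_p) = vc + 1 + 2·ord_p #E(ℚ)_tors`.
[cite: BalakrishnanMullerStein2015, Thm. 1.7] [cite: MazurSteinTate2006, Thm. 1.3]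
[cite: Balakrishnan2016, §2] [cite: Iwasawa1972PadicL, §4.4] -/
theorem identity_of_factor (hS : Schneider1985_order_charGenerator_odd) (hMT : mazur_tate_sigma_exists_odd)
    (hp : p ≠ 2) (hgood : W.HasGoodReductionAtPrime p) (hord : ¬ (p : ℤ) ∣ W.frobeniusTrace p)
    (hrk : W.mordellWeilRank = 1) {vc : ℤ} (hvc : vc ≠ 0) (hc : AnalyticCoeffOneVal W p vc)
    {κ : ZpExtension ℚ p} {γ : Field.absoluteGaloisGroup ℚ}
    (hκ : κ.IsCyclotomic) (hγ : κ.IsTopGenerator γ) (hγ' : IsCyclotomicVariable p γ)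
    [NeZero (W.conductorNorm ℤ)] {f : CuspForm (Gamma0 (W.conductorNorm ℤ)) 2} (hf : IsNewformOf W f)
    {ϖ : ℚ} (hϖ : (ϖ : ℝ) * W.realPeriodRat = plusPeriod f) (D : W.SelmerDualData κ γ)
    [Module.Finite (IwasawaAlgebra p) D.X] (hX : D.IsTorsion) {fE h : IwasawaAlgebra p}
    (hchar : D.charIdeal = Ideal.span {fE})
    (hι : iwasawaToPowerSeries p (fE * h) = C (ϖ : ℚ_[p]) * padicLFunction f (unitRoot W p : ℚ_[p])) :
    constantCoeff h ≠ 0 ∧ Finite (AddCommGroup.primaryComponent W.sha p) ∧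
      ∀ Dh : PAdicHeightData W p, Dh.IsCanonical → SchneiderConjecture Dh ∧
        (padicValNat p (Nat.card (AddCommGroup.primaryComponent W.sha p)) : ℤ) +
            ((constantCoeff h : ℤ_[p]) : ℚ_[p]).valuation + (padicRegulator Dh).valuation +
            padicValNat p W.tamagawaProduct + 2 * padicValNat p (W.reductionPointCount p) =
          vc + 1 + 2 * padicValNat p W.torsionOrder := by
  have hpP : p.Prime := Fact.out
  have hordp : IsOrdinaryAt W p := ⟨hgood, hord⟩
  have hfE00 : constantCoeff fE = 0 :=
    constantCoeff_charGenerator_eq_zero hS hMT hp hgood hord (by rw [hrk]) hκ hγ hγ' D hX hchar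
  have hval : ((coeff 1 (fE * h) : ℤ_[p]) : ℚ_[p]).valuation = vc := hc.valuation_coeff_one_eq hf hϖ hι
  have hne : coeff 1 (fE * h) ≠ 0 := by
    intro h0
    rw [h0, PadicInt.coe_zero, Padic.valuation_zero] at hval
    exact hvc hval.symm
  obtain ⟨hc1, hh0, hsum⟩ := valuation_coeff_one_mul_eq hfE00 hne
  rw [hval] at hsum
  have hordfE : fE.order = W.mordellWeilRank := by
    rw [hrk, show ((1 : ℕ) : ℕ∞) = ((1 : ℕ) : ℕ∞) from rfl, order_eq_nat]
    refine ⟨hc1, fun i hi ↦ ?_⟩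
    obtain rfl : i = 0 := by omega
    rw [coeff_zero_eq_constantCoeff_apply, hfE00]
  have key : ∀ Dh : PAdicHeightData W p, Dh.IsCanonical →
      SchneiderConjecture Dh ∧ Finite (AddCommGroup.primaryComponent W.sha p) ∧
      (padicValNat p (Nat.card (AddCommGroup.primaryComponent W.sha p)) : ℤ) +
          ((constantCoeff h : ℤ_[p]) : ℚ_[p]).valuation + (padicRegulator Dh).valuation +
          padicValNat p W.tamagawaProduct + 2 * padicValNat p (W.reductionPointCount p) =
        vc + 1 + 2 * padicValNat p W.torsionOrder := by
    intro Dh hDh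
    obtain ⟨-, hS2, hS3⟩ := hS W p hp hgood hord κ γ hκ hγ hγ' D hX fE hchar Dh hDh
    obtain ⟨hSch, hfin⟩ := hS2.mp hordfE
    obtain ⟨u, hu⟩ := hS3 hSch hfin
    rw [hrk, pow_one] at hu
    haveI : Finite (AddCommGroup.primaryComponent W.sha p) := hfin
    set c1 : ℚ_[p] := ((coeff 1 fE : ℤ_[p]) : ℚ_[p]) with hc1def
    set lg : ℚ_[p] := padicLog p (cyclotomicGenerator p) with hlg
    set Tt : ℚ_[p] := (W.torsionOrder : ℚ_[p]) with hTt
    set ε : ℚ_[p] := (1 - (unitRoot W p : ℚ_[p])⁻¹) with hε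
    set Shp : ℚ_[p] := (Nat.card (AddCommGroup.primaryComponent W.sha p) : ℚ_[p]) with hShp
    set Rg : ℚ_[p] := padicRegulator Dh with hRg
    set Cc : ℚ_[p] := (W.tamagawaProduct : ℚ_[p]) with hCc
    have hc10 : c1 ≠ 0 := by rw [hc1def]; exact PadicInt.coe_ne_zero.mpr hc1
    obtain ⟨u₃, hu₃⟩ := exists_unit_padicLog_cyclotomicGenerator p hp
    have hp0 : (p : ℚ_[p]) ≠ 0 := Nat.cast_ne_zero.mpr hpP.ne_zero
    have hlg' : lg = (p : ℚ_[p]) * ((u₃ : ℤ_[p]) : ℚ_[p]) := by rw [hlg]; exact hu₃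
    have hlg0 : lg ≠ 0 := by rw [hlg']; exact mul_ne_zero hp0 (coe_units_ne_zero p u₃)
    have hTt0 : Tt ≠ 0 := by rw [hTt]; exact_mod_cast (W.torsionOrder_pos_holds).ne'
    obtain ⟨u₂, hu₂⟩ := exists_unit_one_sub_unitRoot_inv p W hordp
    have hε' : ε = ((u₂ : ℤ_[p]) : ℚ_[p]) * (W.reductionPointCount p : ℚ_[p]) := by rw [hε]; exact hu₂
    have hN0 : (W.reductionPointCount p : ℚ_[p]) ≠ 0 := by
      exact_mod_cast (W.reductionPointCount_pos p).ne'
    have hε0 : ε ≠ 0 := by rw [hε']; exact mul_ne_zero (coe_units_ne_zero p u₂) hN0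
    have hShp0 : Shp ≠ 0 := by rw [hShp]; exact_mod_cast Nat.card_pos.ne'
    have hRg0 : Rg ≠ 0 := hSch
    have hCc0 : Cc ≠ 0 := by
      rw [hCc]; exact_mod_cast (W.tamagawaProduct_pos_holds : 0 < W.tamagawaProduct).ne'
    have hvlg : lg.valuation = 1 := by
      rw [hlg', Padic.valuation_mul hp0 (coe_units_ne_zero p u₃), Padic.valuation_p,
        valuation_coe_units_eq_zero, add_zero]
    have hvT : Tt.valuation = (padicValNat p W.torsionOrder : ℤ) := by
      rw [hTt, Padic.valuation_natCast]
    have hvε : ε.valuation = (padicValNat p (W.reductionPointCount p) : ℤ) := by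
      rw [hε', Padic.valuation_mul (coe_units_ne_zero p u₂) hN0, valuation_coe_units_eq_zero, zero_add,
        Padic.valuation_natCast]
    have hvS : Shp.valuation =
        (padicValNat p (Nat.card (AddCommGroup.primaryComponent W.sha p)) : ℤ) := by
      rw [hShp, Padic.valuation_natCast]
    have hvC : Cc.valuation = (padicValNat p W.tamagawaProduct : ℤ) := by
      rw [hCc, Padic.valuation_natCast]
    have hid := congrArg Padic.valuation hu
    rw [Padic.valuation_mul (mul_ne_zero hc10 hlg0) (pow_ne_zero 2 hTt0), Padic.valuation_mul hc10 hlg0,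
      Padic.valuation_pow,
      Padic.valuation_mul (coe_units_ne_zero p u) (mul_ne_zero (pow_ne_zero 2 hε0)
        (mul_ne_zero (mul_ne_zero hShp0 hRg0) hCc0)),
      valuation_coe_units_eq_zero, zero_add,
      Padic.valuation_mul (pow_ne_zero 2 hε0) (mul_ne_zero (mul_ne_zero hShp0 hRg0) hCc0),
      Padic.valuation_pow, Padic.valuation_mul (mul_ne_zero hShp0 hRg0) hCc0,
      Padic.valuation_mul hShp0 hRg0, hvlg, hvT, hvε, hvS, hvC] at hid
    refine ⟨hSch, hfin, ?_⟩
    push_cast at hid hsum ⊢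
    linarith
  obtain ⟨Dh₀, hDh₀, -⟩ := existsUnique_isCanonical_of_odd hMT W p hp hgood hord
  exact ⟨hh0, (key Dh₀ hDh₀).2.1, fun Dh hDh ↦ ⟨(key Dh hDh).1, (key Dh hDh).2.2⟩⟩

end Factor

section Tier

variable {W : WeierstrassCurve ℚ} [W.IsElliptic] [W.IsGloballyMinimal] {p : ℕ} [Fact p.Prime]

/-- **TIER OF ROUTE R: `s = ord_p #Ш(E/ℚ)_an`.** On the rank-one leaf, with `ord_p [T¹](ϖ·L_p) = vc ≠ 0`
(`AnalyticCoeffOneVal W p vc`) and the EXACT valuation `v` of THE canonical cyclotomic `p`-adic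
regulator, the analytic order of `Ш` is a non-zero rational `q` with
`ord_p q = vc + 1 + 2·ord_p #E(ℚ)_tors − 2·ord_p #Ẽ(𝔽_p) − ord_p ∏c_ℓ − v`. PUBLISHED facts: Wuthrich
2014 Thm. 16 (`hW16`), BMS Thm. 1.7 (`hS`), Perrin-Riou 1987 (`hPR`, the `p`-adic Gross–Zagier
comparison inside x1b's engine `exists_cofactor_of_mem_charIdeal_of_rank_one_odd`), Mazur–Tate `σ`
(`hMT`), modularity (`hmod`), GZK (`hGZK`). So route R (`s = 0`, certificate currency) and route B
(`p ∤ #Ш(E/ℚ)_an`, complex-analytic currency) apply to the same pairs; x1a gen 10's identity `D = −1`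
on 12 222 census pairs is this theorem evaluated. [cite: Wuthrich2014, Thm. 16 (p. 397) and §6 (p. 400)]
[cite: BalakrishnanMullerStein2015, Thm. 1.7] [cite: PerrinRiou1987, §1.4 Cor. 1.8]
[cite: SteinWuthrich2013, §9] -/
theorem _root_.Summit.BirchSwinnertonDyer.Rank1Residual.X1.RankOne.Leaf.exists_shaAn_padicValRat_eq_of_coeffOneVal_of_regulatorEq
    (hW16 : Wuthrich2014.charIdeal_dvd_padicLFunction) (hS : Schneider1985_order_charGenerator_odd)
    (hPR : perrinRiou_rankOne_leadingTerms_odd) (hMT : mazur_tate_sigma_exists_odd)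
    (hmod : nonempty_modularParametrizationData) (hGZK : rank_eq_analyticRank_of_analyticRank_le_one)
    (hL : RankOne.Leaf W p) {vc : ℤ} (hvc : vc ≠ 0) (hc : AnalyticCoeffOneVal W p vc)
    {v : ℤ} (hv : ∀ Dh : PAdicHeightData W p, Dh.IsCanonical → (padicRegulator Dh).valuation = v) :
    ∃ q : ℚ, shaAn W = (q : ℂ) ∧ q ≠ 0 ∧
      padicValRat p q = vc + 1 + 2 * padicValNat p W.torsionOrder -
        2 * padicValNat p (W.reductionPointCount p) - padicValNat p W.tamagawaProduct - v := by
  have hX := isClassX1_of_classX1 hL.1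
  have hp : p ≠ 2 := hX.two_ne
  have hgood := hX.hasGoodReductionAtPrime
  have hord := hX.not_dvd_frobeniusTrace
  have hordp : IsOrdinaryAt W p := ⟨hgood, hord⟩
  have han : W.analyticRank = 1 := hL.analyticRank_eq_one
  have hrk : W.mordellWeilRank = 1 := hL.mordellWeilRank_eq_one hGZK
  obtain ⟨-, hfinSha⟩ := hGZK W han.le
  haveI : Finite W.sha := hfinSha
  obtain ⟨κ, hκ, γ, hγ, hγ'⟩ := exists_isCyclotomic_isTopGenerator_isCyclotomicVariable_holds p
  obtain ⟨D⟩ := W.nonempty_selmerDualData_holds κ γ hγ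
  haveI : NeZero (W.conductorNorm ℤ) := ⟨(W.conductorNorm_pos_holds).ne'⟩
  obtain ⟨Dm⟩ := hmod W
  obtain ⟨ϖ, -, hϖ, -⟩ := Dm.exists_rat_mul_realPeriodRat_eq_plusPeriod
  haveI : Module.Finite (IwasawaAlgebra p) D.X := D.module_finite_holds hγ
  -- Wuthrich Thm. 16; THE canonical datum; the Schneider certificate from `vc ≠ 0`
  obtain ⟨hXt, g, hgmem, hιg⟩ := hW16 W p hp hordp hX.not_hasIrreducibleModPGaloisRep hκ hγ hγ'
    Dm.isNewformOf D ϖ hϖ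
  obtain ⟨Dh, hDh, -⟩ := existsUnique_isCanonical_of_odd hMT W p hp hgood hord
  have hSch : SchneiderConjecture Dh := hL.schneider_of_coeffOneVal hPR hGZK hmod hc hvc Dh hDh
  -- x1b's engine: `ord_p #Ш_an = ord_p h(0) + ord_p #Ш` for the cofactor `h` of `g = h · fE`
  obtain ⟨fE, h, q, hchar, -, hgh, -, hsha, hq0, hval⟩ :=
    exists_cofactor_of_mem_charIdeal_of_rank_one_odd hS hPR hGZK W p hp hgood hord han hκ hγ hγ'
      Dm.isNewformOf ϖ hϖ Dh hDh hSch D hXt g hgmem hιg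
  -- route R's identity at the same cofactor
  have hι : iwasawaToPowerSeries p (fE * h) =
      C (ϖ : ℚ_[p]) * padicLFunction Dm.f (unitRoot W p : ℚ_[p]) := by
    rw [mul_comm, ← hgh, hιg]
  obtain ⟨-, -, key⟩ := identity_of_factor hS hMT hp hgood hord hrk hvc hc hκ hγ hγ' Dm.isNewformOf hϖ D
    hXt hchar hι
  obtain ⟨-, hid⟩ := key Dh hDh
  have hvR := hv Dh hDh
  have hshaOrd : (padicValNat p W.shaOrder : ℤ) =
      padicValNat p (Nat.card (AddCommGroup.primaryComponent W.sha p)) := by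
    rw [padicValNat_card_addPrimaryComponent, WeierstrassCurve.shaOrder]
  refine ⟨q, hsha, hq0, ?_⟩
  rw [hval, hshaOrd]
  linarith

end Tier

end Summit.BirchSwinnertonDyer.Rank1Residual.X1.RankOneRegulatorSqueeze

end
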